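import Summits.QuantumFields.YangMills.Theorems.BalabanUVNodesProp4AtRecordConeRadius
import Summits.QuantumFields.YangMills.Theorems.BalabanUVNodesC44IterMhConePr
import HarnessLib

/-!
# [B11] PROP. 4 AT THE RECORD, FRAMED EDITION (ρ-frame-min) — THE NODE-00 CONE DOOR AT A FREE RADIUS `0 < r′ ≤ r`, re-keyed at node00-def-Y's framed letters over a frame datum `𝔥`
# (twin of ✓`BalabanUVNodesProp4AtRecordConeRadius` §2; «the 7 G-door names» part 3)

Cell `pub-ymgap` ∕ `ym-nodeO-ideate`, porter lineage `ymgap-nodeO-port-PTB-1` (gen 9); re-press (B) of director-ym g23 №608 (ROAD WORD FINAL); filed behind (A2)∕(A3) and ✓`…C44IterMhConePr`;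
`--kind proof --supports stmt-QuantumFields-27238 --as helper`; count-neutral; NEW basename, append-nothing (the frame-free file stays; its §1 ✓`prop4LetterNum_of_le` is chart-free and
reused).  [B7] = [Balaban1985Averaging]; [B11] = [Balaban1985Variational]; [BIII] = [Balaban1985BackgroundPropagators].

RE-KEYING RULE (def-Y PRICE #2 (B)): as in ✓`…C44IterMhConePr` — framed letters, `C₂ ↦ 3.2·10¹⁶·L·N`, displayed `hc`∕(hdom)∕(hnear) (frame bounds) and (hmap)∕(hderiv) (frame
block-locality) threaded; proof word for word.  NOT re-pressed here: ✓`…Prop4KernelLetterHOfEntryBoundsPr` — its suppliers `h1Col0`∕`h1Entry₀,₁`∕`prop4LetterHAtRecord_of_h1EntryBounds`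
(dag-n07-e) and `klH_of_h1EntryBounds` (dag-n06-l) are keyed on `H1OfRecordAtBgFlat` and sit in PRICE #2 (C) (the deferred K0ᴬ-continuation remainder); it rides behind THEIR twins.

WHAT IS PROVED (0 def, 0 sorry, axioms standard; ns `Summit.QuantumFields.YangMills.Theorems.Prop4UniformAtRecord`): ★★★ `prop4UniformPrAtRecord_node00_of_coneLetter_radius`.

HONEST FRAMING.  Glue re-keyed; (ℓa-H)ᵖʳ, (KL-H)ᵖʳ, (KL-N)ᵖʳ, the on-cone entry letter, the frame bounds and the frame block-locality are DISPLAYED binders, NOT proved; no frame is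
constructed in the tree yet ((A1) is node00-def-Y's); (R1)∕(R2) OPEN; K0ᴬ ⟨stmt-QuantumFields-27238⟩ NOT closed; NODE O 0∕1; COUNT 8∕28 · K 1∕4 UNMOVED; finite `𝕋⁴_{L^K}` at fixed ε —
NOT continuum ∕ ℝ⁴ ∕ OS ∕ Clay; **the Yang–Mills mass gap (Clay) is NOT proved by any of this.**  No `sorry`, `instance`, `notation`, `set_option`; standard axioms.
-/

noncomputable section

open scoped Matrix Matrix.Norms.L2Operator InnerProductSpace ComplexConjugate BigOperators
open Classical

namespace Summit.QuantumFields.YangMills.Theorems.Prop4UniformAtRecord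

open Literature.MathematicalPhysics.QuantumFieldTheory.Balaban1983to89
open Literature.MathematicalPhysics.QuantumFieldTheory.Balaban1983to89.Node00
open T4Continuum BlockAveraging
open B10Eq42TorusConstraint (bondsIn)
open B10Eq38TorusDomains (toFine)
open B9SectCLatticeCarrier (Bond)
open B11Eq103H1Complex (SiteL2K)
open B11Eq115Space (NegSup NegSize levWeight)
open B11Eq90Transpose (single115)
open B11Eq90V0primeCurrent (flat115)
open B11Eq111FrakG (nabla115)
open Summit.QuantumFields.YangMills.Theorems.C44IterMh (prop4LetterCPrAtRecord_of_regular loopProfile_of_regular_below kernelLetterC_of_conePr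
  norm_plaqHolU_unitsOfRecord_sub_one_le_of_plaqSmall plaqSmall_base_of_hreg levWeight_bondLevLit_eq_one levWeight_pairLevLit_eq_one wSup_le_one_of_eq_one
  wInvSup_le_one_of_eq_one)

section Record

variable (F : T4Family) (N : ℕ) [NeZero N] (K k : ℕ) (Ω : ℕ → Set (Site (F.P K) 0)) (U₀ : GaugeField (F.P K) 0 (SU N))
variable [Fact (0 < (F.L : ℝ))] [Fact (0 < (F.P K).eta k)] [Fact (0 < c0Rec F K k)] [Fact (∀ c, 0 < wBRec F K k c)]

/-- ★★★ **[B11] PROP. 4 (97)–(98) AT THE RECORD IN THE NODE-00 REGIME, KERNEL ROUTE, FREE RADIUS** (`0 < k ≤ m + K`, every site in `Ω_k`, ANY `0 < r′ ≤ r`): from (ℓa-H), (KL-H) (one-block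
letter of the record's `H₁(U₀)`), (KL-N) (one-block letter of `Δπ∘H₁(U₀)`), the ON-CONE ENTRY LETTER `‖(D C^{sl,pr}(A)·δ_b X)(c)‖ ≤ g₀‖A‖‖X‖` (`b` in the two-block cone of `c`, `‖A‖ < 2r′`;
[B7] (157)'s shape), the window `2r′·Θ_H·(2d·g₀) ≤ ½`, print's (14) below `k` and `‖J‖ ≤ nJ`: `Prop4UniformPrAtRecord … 𝔥 … r′ Gp C₄ R′` with `R′ = min(r′, (1 − 8bC₂r′)∕16)` and `C₄` the numeric
polynomial (`G := 2d·g₀` inside lit's `θ_E = 2Θ_H^wGℓ`, `θ₃ = (2ℓ+1)Θ_H^wG∕r′`, `θ_E′ = 2Θ′Gℓ`, `ℓ = (1 − 8bC₂r′)⁻¹`).  FRAMED twin of ✓`prop4UniformAtRecord_node00_of_coneLetter_radius`: the G-door ✓`prop4UniformPrAtRecord_of_letters_of_norm_J_le` with (ℓa-C)ᵖʳ := F6ᵖʳ ✓`prop4LetterCPrAtRecord_of_regular`,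
numbers := ✓`prop4LetterNum_of_le`, (ℓb) := ✓`prop4LetterV0AtRecord_of_window` (weights `1`, plaquettes via F8), (ℓc)ᵖʳ := ✓`prop4LetterSymmPrAtRecord_holds`, (ℓd)ᵖʳ := G1ᵖʳ ∘ ✓`kernelLetterC_of_conePr`.
HONEST: glue; the four letters, the frame bounds `hc`∕(hdom)∕(hnear) and the frame block-locality (hmap)∕(hderiv) are DISPLAYED. [cite: Balaban1985Variational, Prop. 4 (97)–(98) pp.292–293, (14) p.280, (44)–(46) p.285, (73) p.289, (86)–(89) p.291; Balaban1985Averaging, Proposition 5 (157) p.42; Balaban1985BackgroundPropagators, (3.132) p.422] -/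
theorem prop4UniformPrAtRecord_node00_of_coneLetter_radius [DecidableEq (PBond (F.P K) k)] (𝔥 : FrameDatum (F.P K) N k U₀) (levB : PBond (F.P K) k → ℕ) (a : ℝ)
    (hpos : ∀ x, x ≠ 0 → 0 < RCLike.re ⟪x, laplaceAOfRecord F N k U₀ (QprOfRecord F N k U₀ 𝔥) (QprimeOfRecord F N k U₀) a x⟫_ℂ)
    (hQ : Function.Surjective (QprOfRecord F N k U₀ 𝔥))
    (Gp : SiteL2K ℂ (F.P K).d (fun _ => (F.P K).sitesPerDir 0) (c0Rec F K k) (WRec N) →ₗ[ℂ]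
      SiteL2K ℂ (F.P K).d (fun _ => (F.P K).sitesPerDir 0) (c0Rec F K k) (WRec N))
    {b α nJ : ℝ} (hkpos : 0 < k) (hkm : k ≤ (F.P K).m + (F.P K).K) (hb : 0 ≤ b) (hΩ : ∀ x, x ∈ Ω k) (hα0 : 0 ≤ α) (hα : α * (11000000 * N) ≤ 1)
    (hreg : ∀ j, j < k → PlaqSmall (α * ((F.L : ℝ) ^ j * (F.P K).eta k) ^ 2) (Averaging.iter (avOfRecord F N K) j U₀))
    {c𝔥 : ℝ} (hc : c𝔥 ≤ 1000)
    (hdom : ∀ Y : PBond (F.P K) 0 → Matrix (Fin N) (Fin N) ℂ, (∀ b, (Y b).trace = 0) → (F.L : ℝ) ^ k * ‖Y‖ < 1 / (25000000000 * (F.L : ℝ) * N) →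
      expOver U₀ Y ∈ 𝔥.dom)
    (hnear : ∀ Y : PBond (F.P K) 0 → Matrix (Fin N) (Fin N) ℂ, (∀ b, (Y b).trace = 0) → (F.L : ℝ) ^ k * ‖Y‖ < 1 / (25000000000 * (F.L : ℝ) * N) →
      ∀ y : Site (F.P K) k, ‖𝔥.map (expOver U₀ Y) y - 1‖ ≤ c𝔥 * ((F.L : ℝ) ^ k * ‖Y‖) ∧ ‖𝔥.inv (expOver U₀ Y) y - 1‖ ≤ c𝔥 * ((F.L : ℝ) ^ k * ‖Y‖))
    (hmap : ∀ Y : Set (Site (F.P K) 0), (∀ i, i < k → ∀ s : Site (F.P K) i, toFine i s ∈ Y ↔ toFine (i + 1) (blockOf s) ∈ Y) →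
      ∀ V V' : PBond (F.P K) 0 → Matrix (Fin N) (Fin N) ℂ, (∀ b : PBond (F.P K) 0, b ∈ bondsIn 0 Y → V b = V' b) →
      ∀ y : Site (F.P K) k, toFine k y ∈ Y → 𝔥.map V y = 𝔥.map V' y ∧ 𝔥.inv V y = 𝔥.inv V' y)
    (hderiv : ∀ Y : Set (Site (F.P K) 0), (∀ i, i < k → ∀ s : Site (F.P K) i, toFine i s ∈ Y ↔ toFine (i + 1) (blockOf s) ∈ Y) →
      ∀ Z Z' : PBond (F.P K) 0 → Matrix (Fin N) (Fin N) ℂ, (∀ b : PBond (F.P K) 0, b ∈ bondsIn 0 Y → Z b = Z' b) →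
      ∀ y : Site (F.P K) k, toFine k y ∈ Y → 𝔥.deriv Z y = 𝔥.deriv Z' y)
    (hH : Prop4LetterHPrAtRecord F N K k Ω U₀ 𝔥 levB a hpos hQ b)
    -- the radius
    {r' : ℝ} (hr'0 : 0 < r')
    (hr'le : letI C₂ : ℝ := 32000000000000000 * (F.L : ℝ) * N
      letI c₄ : ℝ := 1 / (200000000000 * (F.L : ℝ) * N)
      r' ≤ min (c₄ / 4) (min (1 / 2) (1 / (16 * (b * C₂ + 1)))))
    -- (KL-H)
    {hk : Bond (F.P K).d (fun _ => (F.P K).sitesPerDir 0) → PBond (F.P K) k → ℝ} (hk0 : ∀ b' y, 0 ≤ hk b' y)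
    (hHk : ∀ (y : PBond (F.P K) k) (Z : Matrix (Fin N) (Fin N) ℂ) (b' : Bond (F.P K).d (fun _ => (F.P K).sitesPerDir 0)),
      ‖flat115 (H1prOfRecordAtBg F N K k Ω U₀ 𝔥 levB a hpos hQ
          ((NegSup.equiv (levWeight (F.L : ℝ) ((F.P K).eta k) levB 0) (Matrix (Fin N) (Fin N) ℂ)).symm (Pi.single y Z))) b'‖ ≤ hk b' y * ‖Z‖)
    {ΘH : ℝ} (hΘH : 0 ≤ ΘH) (hH1 : ∀ y, ∑ b', hk b' y ≤ ΘH) {ΘHw : ℝ} (hΘHw : 0 ≤ ΘHw)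
    (hHw : ∀ (bb : Bond (F.P K).d (fun _ => (F.P K).sitesPerDir 0)) (y : PBond (F.P K) k),
      ∑ b', levWeight (F.L : ℝ) ((F.P K).eta k) (bondLevLit F Ω k) 3 bb / levWeight (F.L : ℝ) ((F.P K).eta k) (bondLevLit F Ω k) 3 b' * hk b' y ≤ ΘHw)
    -- the on-cone entry letter of `D C^{sl}` on `‖A‖ < 2r′`, and the window
    {g₀ : ℝ} (hg₀ : 0 ≤ g₀)
    (hg : ∀ A : Space115Lit F N K k Ω U₀, ‖A‖ < r' + r' → ∀ (bb : Bond (F.P K).d (fun _ => (F.P K).sitesPerDir 0)) (X : Matrix (Fin N) (Fin N) ℂ) (c : PBond (F.P K) k),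
      (bondToLit (F.P K) 0).symm bb ∈ bondsIn 0 {x : Site (F.P K) 0 | B14.Eq22Determines.blockIter k x = c.src ∨ B14.Eq22Determines.blockIter k x = c.tgt} →
      ‖NegSup.equiv (levWeight (F.L : ℝ) ((F.P K).eta k) levB 0) (Matrix (Fin N) (Fin N) ℂ)
        (fderiv ℂ (CslprOfRecord F N K k Ω U₀ 𝔥 levB) A
          (single115 (lev₁ := pairLevLit F Ω k) (Dc := nabla115 ((F.P K).eta k) (unitsOfRecord F N U₀)) bb X)) c‖ ≤ g₀ * ‖A‖ * ‖X‖)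
    (hq : (r' + r') * ΘH * (2 * ((F.P K).d : ℝ) * g₀) ≤ 1 / 2)
    -- (KL-N)
    {hk' : Bond (F.P K).d (fun _ => (F.P K).sitesPerDir 0) → PBond (F.P K) k → ℝ} (hk'0 : ∀ b' y, 0 ≤ hk' b' y)
    (hNk : ∀ (y : PBond (F.P K) k) (Z : Matrix (Fin N) (Fin N) ℂ) (b' : Bond (F.P K).d (fun _ => (F.P K).sitesPerDir 0)),
      ‖NegSup.equiv (levWeight (F.L : ℝ) ((F.P K).eta k) (bondLevLit F Ω k) 3) (Matrix (Fin N) (Fin N) ℂ)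
        (DeltaPiCurOfRecord F N K k Ω U₀ Gp (QprimeOfRecord F N k U₀) (H1prOfRecordAtBg F N K k Ω U₀ 𝔥 levB a hpos hQ
          ((NegSup.equiv (levWeight (F.L : ℝ) ((F.P K).eta k) levB 0) (Matrix (Fin N) (Fin N) ℂ)).symm (Pi.single y Z)))) b'‖ ≤ hk' b' y * ‖Z‖)
    {Θ' : ℝ} (hΘ'0 : 0 ≤ Θ')
    (hΘ' : ∀ (bb : Bond (F.P K).d (fun _ => (F.P K).sitesPerDir 0)) (y : PBond (F.P K) k),
      ∑ b', levWeight (F.L : ℝ) ((F.P K).eta k) (bondLevLit F Ω k) 3 bb / levWeight (F.L : ℝ) ((F.P K).eta k) (bondLevLit F Ω k) 1 b' * hk' b' y ≤ Θ')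
    {N₁ : ℝ} (hN₁0 : 0 ≤ N₁)
    (hN₁ : ∀ b', ∑ y, levWeight (F.L : ℝ) ((F.P K).eta k) (bondLevLit F Ω k) 3 b' / levWeight (F.L : ℝ) ((F.P K).eta k) levB 0 y * hk' b' y ≤ N₁)
    (hJ : ‖JOfRecordAtBg F N K k Ω U₀‖ ≤ nJ) :
    letI C₂ : ℝ := 32000000000000000 * (F.L : ℝ) * N
    letI R' : ℝ := min r' ((1 - 4 * b * C₂ * (r' + r')) * (1 / 16))
    letI CV : ℝ := 1024 * (((F.P K).d - 1 : ℕ) : ℝ) * ((1 : ℝ) * 1) ^ 3 * N * (α * (1 : ℝ) ^ 2 + 1 / 16)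
        + (((F.P K).d - 1 : ℕ) : ℝ) * ((1 : ℝ) * 1) ^ 3 * (136 + 2 * ((1 : ℝ) * 1)) * N
    letI G : ℝ := 2 * ((F.P K).d : ℝ) * g₀
    letI θ₃ : ℝ := (2 * (1 / (1 - 4 * b * C₂ * (r' + r'))) + 1) * ΘHw * G / r'
    letI θE : ℝ := 2 * ΘHw * G * (1 / (1 - 4 * b * C₂ * (r' + r')))
    letI θE' : ℝ := 2 * Θ' * G * (1 / (1 - 4 * b * C₂ * (r' + r')))
    Prop4UniformPrAtRecord F N K k Ω U₀ 𝔥 levB a hpos hQ r' Gp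
      ((N * θ₃ * nJ + (N₁ * C₂ * (1 / (1 - 4 * b * C₂ * (r' + r'))) ^ 2 + N * θE')
        + N * θE * (N₁ * C₂ * (1 / (1 - 4 * b * C₂ * (r' + r'))) ^ 2) * R'
        + N * (1 + θE * R') * CV * (1 / (1 - 4 * b * C₂ * (r' + r'))) ^ 2)) R' := by
  have hLN : (0 : ℝ) < (F.L : ℝ) * N := mul_pos Fact.out (by exact_mod_cast Nat.pos_of_ne_zero (NeZero.ne N))
  have hC₂ : (0 : ℝ) ≤ 32000000000000000 * (F.L : ℝ) * N := by rw [mul_assoc]; positivity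
  have hnum := prop4LetterNum_of_le hb hC₂ (by norm_num : (0 : ℝ) < 1 / 16) hr'0 hr'le
  have hC := prop4LetterCPrAtRecord_of_regular F N k Ω U₀ 𝔥 levB hΩ hα0 hα hreg hc hdom hnear
  have hU₀ : SmallBelow (avOfRecord F N K) k U₀ := (loopProfile_of_regular_below F N k U₀ le_rfl hα0 hα hreg).1
  obtain ⟨hgC0, hCg, hG⟩ := kernelLetterC_of_conePr F N K k Ω U₀ hkm 𝔥 levB hU₀ hmap hderiv hg₀ hg
  have hG0 : 0 ≤ 2 * ((F.P K).d : ℝ) * g₀ := by positivity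
  have hcol := prop4LetterColumnsPrAtRecord_of_kernelLetters F N K k Ω U₀ 𝔥 levB a hpos hQ Gp hH hC hnum hr'0 hk0 hHk hΘH hH1 hΘHw hHw hgC0 hCg hG0 hG hq
    hk'0 hNk hΘ'0 hΘ' hN₁0 hN₁
  have hpl := norm_plaqHolU_unitsOfRecord_sub_one_le_of_plaqSmall F N U₀ (plaqSmall_base_of_hreg F N U₀ hkpos hreg)
  have hwb : ∀ i, levWeight (F.L : ℝ) ((F.P K).eta k) (bondLevLit F Ω k) 1 i = 1 := levWeight_bondLevLit_eq_one F k Ω hΩ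
  have hwp : ∀ p, levWeight (F.L : ℝ) ((F.P K).eta k) (pairLevLit F Ω k) 2 p = 1 := levWeight_pairLevLit_eq_one F K k Ω hΩ
  have hV := prop4LetterV0AtRecord_of_window F N K k Ω U₀ hα0 hpl le_rfl le_rfl (wSup_le_one_of_eq_one _ hwb) (wInvSup_le_one_of_eq_one _ hwb)
    (wInvSup_le_one_of_eq_one _ hwp)
  have hmain := prop4UniformPrAtRecord_of_letters_of_norm_J_le F N K k Ω U₀ 𝔥 levB a hpos hQ Gp hH hC hnum hV (prop4LetterSymmPrAtRecord_holds F N K k Ω U₀ Gp) hcol hJ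
  obtain ⟨⟨hθ₃, hθE, hθE', hN₁'⟩, -⟩ := hcol
  exact prop4UniformPrAtRecord_mono F N K k Ω U₀ 𝔥 levB a hpos hQ _ Gp hmain
    (c4OfRecord_le_numeric N ((norm_nonneg _).trans hJ) hV.1 hnum.2.2.2.2.2.2.1 hθ₃ hθE hθE' hN₁' hC₂)

end Record

end Summit.QuantumFields.YangMills.Theorems.Prop4UniformAtRecord

end
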